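import Mathlib.Analysis.SpecialFunctions.PolarCoord
import Mathlib.Analysis.SpecialFunctions.Arsinh
import HarnessLib

/-!
# Hyperbolic polar coordinates on a wedge of the plane

The change of variables `(σ, τ) ↦ (σ sinh τ, σ cosh τ)` from `(0, ∞) × ℝ` onto the open wedge
`{(q, s) | |q| < s}`, with Jacobian `σ` (`|det [[sinh τ, σ cosh τ], [cosh τ, σ sinh τ]]| = σ`):

* `lintegral_comp_hyperbolicCoordSymm` :
  `∫⁻_{|q| < s} f(q, s) = ∫⁻_{σ > 0} ∫⁻_τ σ · f(σ sinh τ, σ cosh τ)` (as a set integral over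
  `(0, ∞) × ℝ`), the hyperbolic analogue of Mathlib's `lintegral_comp_polarCoord_symm`.

This is the coordinate system of Lovas–Andai 2017, Appendix A (the atlas `X_±(r, t, ρ, φ)` with
off-diagonal entries `∝ e^{±t}`), in which the similarity `V_ε⁻¹ (·) V_ε` becomes the translation
`τ ↦ τ − δ`; it is used to compute the defect function `χ₁` (Lemma 6).

## References

* [LovasAndai2017] A. Lovas, A. Andai, Invariance of separability probability over reduced states
  in 4 × 4 bipartite systems, J. Phys. A 50 (2017) 295303, Appendix A.
-/

noncomputable section

open MeasureTheory Set Real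
open scoped ENNReal

namespace Literature.InformationTheory.Entanglement

/-- Inverse hyperbolic polar coordinates: `(σ, τ) ↦ (σ sinh τ, σ cosh τ)`. [folklore] -/
def hyperbolicCoordSymm (y : ℝ × ℝ) : ℝ × ℝ :=
  (y.1 * sinh y.2, y.1 * cosh y.2)

/-- `hyperbolicCoordSymm` is continuous. [folklore] -/
@[fun_prop]
theorem continuous_hyperbolicCoordSymm : Continuous hyperbolicCoordSymm := by
  unfold hyperbolicCoordSymm
  fun_prop

/-- The derivative of `hyperbolicCoordSymm`. [folklore] -/
def fderivHyperbolicCoordSymm (y : ℝ × ℝ) : ℝ × ℝ →L[ℝ] ℝ × ℝ :=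
  (Matrix.toLin (.finTwoProd ℝ) (.finTwoProd ℝ)
    !![sinh y.2, y.1 * cosh y.2; cosh y.2, y.1 * sinh y.2]).toContinuousLinearMap

/-- `hyperbolicCoordSymm` has the stated derivative. [folklore] -/
theorem hasFDerivAt_hyperbolicCoordSymm (y : ℝ × ℝ) :
    HasFDerivAt hyperbolicCoordSymm (fderivHyperbolicCoordSymm y) y := by
  unfold fderivHyperbolicCoordSymm
  rw [Matrix.toLin_finTwoProd_toContinuousLinearMap]
  have h1' : HasFDerivAt (fun y : ℝ × ℝ => y.1 * sinh y.2)
      (y.1 • (cosh y.2 • ContinuousLinearMap.snd ℝ ℝ ℝ) +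
        sinh y.2 • ContinuousLinearMap.fst ℝ ℝ ℝ) y :=
    hasFDerivAt_fst.mul ((hasDerivAt_sinh y.2).comp_hasFDerivAt y hasFDerivAt_snd)
  have h1 : HasFDerivAt (fun y : ℝ × ℝ => y.1 * sinh y.2)
      (sinh y.2 • ContinuousLinearMap.fst ℝ ℝ ℝ +
        (y.1 * cosh y.2) • ContinuousLinearMap.snd ℝ ℝ ℝ) y := by
    refine h1'.congr_fderiv ?_
    ext <;> simp [smul_smul, mul_comm]
  have h2' : HasFDerivAt (fun y : ℝ × ℝ => y.1 * cosh y.2)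
      (y.1 • (sinh y.2 • ContinuousLinearMap.snd ℝ ℝ ℝ) +
        cosh y.2 • ContinuousLinearMap.fst ℝ ℝ ℝ) y :=
    hasFDerivAt_fst.mul ((hasDerivAt_cosh y.2).comp_hasFDerivAt y hasFDerivAt_snd)
  have h2 : HasFDerivAt (fun y : ℝ × ℝ => y.1 * cosh y.2)
      (cosh y.2 • ContinuousLinearMap.fst ℝ ℝ ℝ +
        (y.1 * sinh y.2) • ContinuousLinearMap.snd ℝ ℝ ℝ) y := by
    refine h2'.congr_fderiv ?_
    ext <;> simp [smul_smul, mul_comm]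
  exact h1.prodMk h2

/-- The Jacobian determinant: `det = −σ`. [folklore] -/
theorem det_fderivHyperbolicCoordSymm (y : ℝ × ℝ) :
    (fderivHyperbolicCoordSymm y).det = -y.1 := by
  unfold fderivHyperbolicCoordSymm
  simp only [LinearMap.det_toContinuousLinearMap, LinearMap.det_toLin, Matrix.det_fin_two_of]
  have h := cosh_sq y.2
  linear_combination y.1 * h.symm - y.1 * h.symm + (-y.1) * h

/-- `hyperbolicCoordSymm` is injective on `(0, ∞) × ℝ`. [folklore] -/
theorem injOn_hyperbolicCoordSymm :
    InjOn hyperbolicCoordSymm (Ioi (0 : ℝ) ×ˢ (univ : Set ℝ)) := by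
  rintro ⟨σ, τ⟩ ⟨hσ, -⟩ ⟨σ', τ'⟩ ⟨hσ', -⟩ h
  simp only [hyperbolicCoordSymm, Prod.mk.injEq] at h
  obtain ⟨hq, hs⟩ := h
  have hσσ : σ ^ 2 = σ' ^ 2 := by
    have e1 : (σ * cosh τ) ^ 2 - (σ * sinh τ) ^ 2 = σ ^ 2 := by
      have := cosh_sq τ; nlinarith [this]
    have e2 : (σ' * cosh τ') ^ 2 - (σ' * sinh τ') ^ 2 = σ' ^ 2 := by
      have := cosh_sq τ'; nlinarith [this]
    rw [← e1, ← e2, hq, hs]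
  have hσeq : σ = σ' := by
    have := (pow_left_inj₀ (le_of_lt hσ) (le_of_lt hσ') two_ne_zero).1 hσσ
    exact this
  subst hσeq
  have hτ : sinh τ = sinh τ' := mul_left_cancel₀ (ne_of_gt hσ) hq
  simp only [Prod.mk.injEq, true_and]
  exact sinh_injective hτ

/-- The image of `(0, ∞) × ℝ` is the open upper wedge `{|q| < s}`. [folklore] -/
theorem image_hyperbolicCoordSymm :
    hyperbolicCoordSymm '' (Ioi (0 : ℝ) ×ˢ (univ : Set ℝ)) = {x : ℝ × ℝ | |x.1| < x.2} := by
  ext ⟨q, s⟩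
  constructor
  · rintro ⟨⟨σ, τ⟩, ⟨hσ, -⟩, h⟩
    have hσ' : 0 < σ := hσ
    simp only [hyperbolicCoordSymm, Prod.mk.injEq] at h
    obtain ⟨rfl, rfl⟩ := h
    simp only [mem_setOf_eq, abs_mul, abs_of_pos hσ']
    have hc : |sinh τ| < cosh τ := by
      rw [abs_lt]
      constructor
      · have h1 := cosh_pos τ
        have h2 : sinh τ + cosh τ = exp τ := by rw [sinh_eq, cosh_eq]; ring
        nlinarith [exp_pos τ]
      · exact sinh_lt_cosh τ
    exact mul_lt_mul_of_pos_left hc hσ'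
  · intro h
    simp only [mem_setOf_eq] at h
    have hs : 0 < s := lt_of_le_of_lt (abs_nonneg q) h
    have hsq : 0 < s ^ 2 - q ^ 2 := by
      have : |q| ^ 2 < s ^ 2 := by
        exact pow_lt_pow_left₀ h (abs_nonneg q) two_ne_zero
      rw [sq_abs] at this
      linarith
    set σ := Real.sqrt (s ^ 2 - q ^ 2) with hσ_def
    have hσ : 0 < σ := Real.sqrt_pos.2 hsq
    have hσ2 : σ ^ 2 = s ^ 2 - q ^ 2 := Real.sq_sqrt hsq.le
    refine ⟨(σ, arsinh (q / σ)), ⟨hσ, mem_univ _⟩, ?_⟩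
    simp only [hyperbolicCoordSymm, sinh_arsinh, cosh_arsinh, Prod.mk.injEq]
    constructor
    · field_simp
    · have h1 : σ * Real.sqrt (1 + (q / σ) ^ 2) = Real.sqrt (σ ^ 2 + q ^ 2) := by
        have h3 : σ * Real.sqrt (1 + (q / σ) ^ 2) = Real.sqrt (σ ^ 2 * (1 + (q / σ) ^ 2)) := by
          rw [Real.sqrt_mul (sq_nonneg σ), Real.sqrt_sq hσ.le]
        rw [h3]
        congr 1
        field_simp
      rw [h1, hσ2]
      have : s ^ 2 - q ^ 2 + q ^ 2 = s ^ 2 := by ring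
      rw [this, Real.sqrt_sq hs.le]

/-- The open upper wedge is measurable. [folklore] -/
theorem measurableSet_wedge : MeasurableSet {x : ℝ × ℝ | |x.1| < x.2} :=
  (isOpen_lt (by fun_prop) continuous_snd).measurableSet

/-- **Integration in hyperbolic polar coordinates** on the wedge `{|q| < s}`:
`∫⁻_{|q| < s} f(q, s) = ∫⁻_{(σ, τ) ∈ (0, ∞) × ℝ} σ · f(σ sinh τ, σ cosh τ)`.
[cite: LovasAndai2017, Appendix A (the atlas of the proof of Lemma 6)] -/
theorem lintegral_comp_hyperbolicCoordSymm (f : ℝ × ℝ → ℝ≥0∞) :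
    ∫⁻ x in {x : ℝ × ℝ | |x.1| < x.2}, f x =
      ∫⁻ y in Ioi (0 : ℝ) ×ˢ (univ : Set ℝ), ENNReal.ofReal y.1 * f (hyperbolicCoordSymm y) := by
  rw [← image_hyperbolicCoordSymm,
    lintegral_image_eq_lintegral_abs_det_fderiv_mul volume
      (measurableSet_Ioi.prod MeasurableSet.univ)
      (fun y _ => (hasFDerivAt_hyperbolicCoordSymm y).hasFDerivWithinAt)
      injOn_hyperbolicCoordSymm]
  refine setLIntegral_congr_fun (measurableSet_Ioi.prod MeasurableSet.univ) fun y hy => ?_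
  rw [det_fderivHyperbolicCoordSymm, abs_neg, abs_of_pos hy.1]

/-- **Tonelli form**: `∫⁻_{|q| < s} f(q, s) = ∫⁻_{σ > 0} ∫⁻_τ σ · f(σ sinh τ, σ cosh τ)` for
measurable `f`. [cite: LovasAndai2017, Appendix A] -/
theorem lintegral_wedge_eq_lintegral_Ioi_lintegral {f : ℝ × ℝ → ℝ≥0∞} (hf : Measurable f) :
    ∫⁻ x in {x : ℝ × ℝ | |x.1| < x.2}, f x =
      ∫⁻ σ in Ioi (0 : ℝ), ∫⁻ τ : ℝ, ENNReal.ofReal σ * f (σ * sinh τ, σ * cosh τ) := by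
  rw [lintegral_comp_hyperbolicCoordSymm, Measure.volume_eq_prod, setLIntegral_prod]
  · simp only [Measure.restrict_univ]
    rfl
  · refine Measurable.aemeasurable ?_
    exact (ENNReal.measurable_ofReal.comp measurable_fst).mul
      (hf.comp continuous_hyperbolicCoordSymm.measurable)

end Literature.InformationTheory.Entanglement

end
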